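import Summits.ABC.IUTFork.LDHGenuinePerImageSufficiencyPoint
import Summits.ABC.ABC.Theorems.IUTThetaPilotThetaPartIIOfCor312PerImage
import HarnessLib

/-!
# INV-EMBED (lens `embed`, seat abc-iut-inv-1) — the EMBED-PARENT FLOOR for the RESHAPE-4 stub of `ThetaPartII`

Crux workfile (record-only sketch; crux `ThetaPartII` = stmt-ABC-19678 of route-ABC-IUTThetaPilot, RESHAPE-4
3177a83aca8d622d, remaining stub `stub_cor312PerImage`). NO new route, NO item, NO side taken on [IUTchIII] Cor. 3.12
or on any author (D-0045); typed ≠ proved; NOT abc.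

An «embed parent» for the lens `embed` (program-embedding, Wiles shape) is ANY statement `C` — of any neighbouring
theory — together with a DICTIONARY making the RESHAPE-4 stub hypothesis family a special case of `C`, i.e. a proof
`C → StubFamily`, where `StubFamily` is literally the `h312` binder of the landed reduction
`Summit.ABC.ABC.Theorems.ThetaPartII_of_cor312PerImage`. Three kernel facts about every such pair `(C, dictionary)`:

* `thetaPartII_of_parent`, `abc_of_parent` (UP): `C` closes the crux, and `ABC` given the proved support `GenEllTwo`
  — nothing but the landed reduction;
* `tameSzpiroSix_of_parent` (DOWN, the floor): `C` proves, at every `P ∈ UP`, every prime `l ≥ 7` satisfying the core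
  conditions `AdmitsCore, (P2), (P5), (P6)`, and every TAME genuine datum `T` of `(P, l)`, Szpiro's inequality
  `(1/6 − 2/(l(l+1)))·log q^{∤{2,l}}(λ) ≤ (1 + (4+8·d_mod)/l)·(log-diff + log-cond) + 5 log l + 46 + 2 log π`
  — by `Summit.ABC.IUTFork.PointDict.szpiro_of_cor312PerImageAtDatum_tame_six` (p437841);
* `tameSzpiroTwelve_of_parent_dmod_one`: the same at `d_mod = 1` with coefficient `1 + 12/l`.

READING for the lens. A theorem `C` of a SETTLED theory (tempered fundamental groups, Berkovich skeleta / tropical theta,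
log-geometry monodromy, combinatorial anabelian geometry) can be an embed parent only if that theory already proves the
tame Szpiro-six family on `U` — none does; so the lens can only be served Wiles-shape (an OPEN structural `C` with proved
fragments), and the dictionary crux (i) then carries the whole Szpiro content. This file asserts nothing about which of
`C`, `StubFamily` or the Szpiro family holds at any point. [cite: Mochizuki2012, IUTchIV Thm. 1.10 p. 22–32; Cor. 2.2 (ii) p. 46]
[claim: Mochizuki2012, status: disputed]
-/

set_option linter.dupNamespace false

noncomputable section

namespace Summit.ABC.ABC.Cruxes.ThetaPartII.InvEmbed

open Literature.NumberTheory.DiophantineGeometry.GenEll Literature.IUT.LogVolume Literature.IUT.HodgeTheaters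
open NumberField IsDedekindDomain Literature.NumberTheory.NumberFields Summit.ABC.IUTFork

/-- The RESHAPE-4 stub hypothesis family: verbatim the `h312` binder of
`Summit.ABC.ABC.Theorems.ThetaPartII_of_cor312PerImage` (display-P line, per-image reading at the Θ-data of `λ`). -/
def StubFamily : Prop :=
  ∀ P : NFPoint, P ∈ UP → ∀ l : ℕ, l.Prime → 5 ≤ l →
    Cor22.AdmitsCore P → Cor22.CondP2 P l → Cor22.CondP5 P l → Cor22.CondP6 P l →
      Cor22.Cor312PerImageAtDatum P l

/-- An EMBED PARENT: a statement `C` of some theory plus the dictionary exhibiting `StubFamily` as a special case of `C`.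
Existence of an INSTANCE with `C` a theorem is NOT part of the structure (never smuggled). -/
structure EmbedParent where
  /-- the structural statement of the neighbouring theory -/
  C : Prop
  /-- the typed dictionary: our stub family is a special case of `C` -/
  specialCase : C → StubFamily

/-- UP: an embed parent whose `C` holds closes the crux `ThetaPartII` (the landed RESHAPE-4 reduction, nothing more). -/
theorem thetaPartII_of_parent (E : EmbedParent) (hC : E.C) :
    Summit.ABC.ABC.Theses.IUTThetaPilot.ThetaPartII :=
  Summit.ABC.ABC.Theorems.ThetaPartII_of_cor312PerImage (E.specialCase hC)

/-- UP to the summit shape: with the proved support `GenEllTwo` an embed parent whose `C` holds gives `ABC`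
(the route's certified `closes`; CONDITIONAL on `hC`, asserts nothing). -/
theorem abc_of_parent (E : EmbedParent) (hC : E.C)
    (hG : Summit.ABC.ABC.Theses.IUTThetaPilot.GenEllTwo) : _root_.ABC :=
  Summit.ABC.ABC.Theorems.ABC_of_cor312PerImage_of_genEllTwo (E.specialCase hC) hG

/-- DOWN — THE EMBED-PARENT FLOOR: an embed parent whose `C` holds proves tame Szpiro with constant `6·(1+O(d_mod/l))`
at every admissible `(P, l)`, `l ≥ 7` prime, satisfying the core conditions, and every TAME genuine datum.
So a settled theory supplies an embed parent only if it proves this Szpiro family. -/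
theorem tameSzpiroSix_of_parent (E : EmbedParent) (hC : E.C) {P : NFPoint} {l : ℕ} (hP : P ∈ UP)
    (hl : l.Prime) (h7 : 7 ≤ l) (hA : Cor22.AdmitsCore P) (h2 : Cor22.CondP2 P l) (h5 : Cor22.CondP5 P l)
    (h6 : Cor22.CondP6 P l) (T : Cor22.ThetaVolumeDatumAt P l)
    (htame : letI := T.instFieldF; letI := T.instNumberFieldF; letI := T.instAlgebraF; letI := T.instFieldK
      letI := T.instNumberFieldK; letI := T.instAlgebraK; letI := T.instIsElliptic
      ∀ (p : ℕ) [hp : Fact p.Prime], p ∈ T.I.supportPrimes → ∀ v : placesOver (fieldOfModuli T.E) p,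
        ¬ p - 2 < absRamificationIdx p ((T.I.σ.localFieldFamily p hp.out).k v)) :
    (1 / 6 - 2 / ((l : ℝ) * ((l : ℝ) + 1))) * Cor22.logQAvoid P {2, l} ≤
      (1 + (4 + 8 * (Cor22.dmod P : ℝ)) / l) * (P.logDiff + Cor22.logCondAvoid P {2, l})
        + 5 * Real.log l + 46 + 2 * Real.log Real.pi :=
  PointDict.szpiro_of_cor312PerImageAtDatum_tame_six hP h7
    (E.specialCase hC P hP l hl (le_trans (by norm_num) h7) hA h2 h5 h6) T htame

/-- DOWN at `d_mod = 1` (`j(λ) ∈ ℚ`): the floor reads `(1/6 − 2/(l(l+1)))·log q^{∤2l} ≤ (1 + 12/l)·(log-diff + log-cond)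
+ 5 log l + 46 + 2 log π` — the second half of `Cor22.cor312PerImageAtDatum_sandwich_dmod_one`. -/
theorem tameSzpiroTwelve_of_parent_dmod_one (E : EmbedParent) (hC : E.C) {P : NFPoint} {l : ℕ} (hP : P ∈ UP)
    (hl : l.Prime) (h7 : 7 ≤ l) (hd : Cor22.dmod P = 1) (hA : Cor22.AdmitsCore P) (h2 : Cor22.CondP2 P l)
    (h5 : Cor22.CondP5 P l) (h6 : Cor22.CondP6 P l) (T : Cor22.ThetaVolumeDatumAt P l)
    (htame : letI := T.instFieldF; letI := T.instNumberFieldF; letI := T.instAlgebraF; letI := T.instFieldK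
      letI := T.instNumberFieldK; letI := T.instAlgebraK; letI := T.instIsElliptic
      ∀ (p : ℕ) [hp : Fact p.Prime], p ∈ T.I.supportPrimes → ∀ v : placesOver (fieldOfModuli T.E) p,
        ¬ p - 2 < absRamificationIdx p ((T.I.σ.localFieldFamily p hp.out).k v)) :
    (1 / 6 - 2 / ((l : ℝ) * ((l : ℝ) + 1))) * Cor22.logQAvoid P {2, l} ≤
      (1 + 12 / (l : ℝ)) * (P.logDiff + Cor22.logCondAvoid P {2, l})
        + 5 * Real.log l + 46 + 2 * Real.log Real.pi :=
  (Cor22.cor312PerImageAtDatum_sandwich_dmod_one hP h7 hd).2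
    (E.specialCase hC P hP l hl (le_trans (by norm_num) h7) hA h2 h5 h6) T htame

/-- SANITY (the trivial parent): `StubFamily` is its own embed parent — the lens has content only when `C` is a
statement of ANOTHER theory with an independent proof theory; this instance records that the structure smuggles nothing. -/
def trivialParent : EmbedParent := ⟨StubFamily, id⟩

end Summit.ABC.ABC.Cruxes.ThetaPartII.InvEmbed

end
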